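import Summits.ValiantsHypothesis.ValiantsHypothesis.Theorems.BarrierLeverAnchoredDoorHitsLowerPairsDefs
import Summits.ValiantsHypothesis.ValiantsHypothesis.Theorems.BarrierLeverPartitionMinorsHitByVPExactCoverDoor

/-!
# Support item `AnchoredDoorHitsLowerPairs` (stmt-ValiantsHypothesis-22510), line `anchored-peeling`: the DOOR SIZE
# `Stmt.anchoredDoor` (the link hypothesis of the skeleton, discharged)

Link file (`--supports stmt-ValiantsHypothesis-22510`; cell valiant-natproofs, rung V4, 𝒟-side door (c); prover seat val-np-p1
gen 14; lane 22510 / `Cruxes/AnchoredDoorHitsLowerPairs/Lines/anchored_peeling.lean`). Closes NO item.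

`anchoredDoor_holds : Stmt.anchoredDoor` — for every profile bound `s` the anchored door 𝔄_s re-budgets into
`SmallCircuits ℂ (h+h) (2s+4)` for `h ≥ 9(s+1)²`: `|anchors s h| ≤ ((s+1) h^s)²` (`card_anchors_le`), each anchor factor has
`≤ 8h + 5` operations (`complexity_anchorFactor_le`), so `L(𝔄_s) ≤ 14 (s+1)² h^{2s+1}` (`complexity_anchoredWitness_le`); the
truncation to degree `≤ 2h` (`AdditiveDoor.truncation_spec`) keeps every partition-matrix entry and costs a factor `(2h+2)²`.
With the skeleton's `PartitionMinorsHitByVP_of_anchored` (kernel-checked there) this makes the line's link to item 19717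
unconditional: `AnchoredDoorHitsLowerPairs → PartitionMinorsHitByVP` (restated here as `partitionMinorsHitByVP_of_anchoredDoorHitsLowerPairs`,
via the landed lower-set reduction).

WHAT THIS IS NOT: routine size bookkeeping; nothing on the content stub `stub_symbolicNonvanishing`, on crux
stmt-ValiantsHypothesis-14610, or on `VP` versus `VNP`.
-/

set_option linter.dupNamespace false

namespace Summit.ValiantsHypothesis.ValiantsHypothesis.Theorems.BarrierLever.AnchoredPeeling

open Finset MvPolynomial
open Literature.Barriers.ValiantsHypothesis Literature.Computability.AlgebraicComplexity
open Summit.ValiantsHypothesis.ValiantsHypothesis.Theorems.BarrierLever.AdditiveDoor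
  (truncation_spec degree_partitionExpo_le)

noncomputable section

variable {h : ℕ}

/-! ## Counting anchors -/

/-- The small faces: `1 ≤ |A| ≤ s`. -/
theorem card_smallFaces_le (s h : ℕ) (hh : 1 ≤ h) :
    ((Finset.univ : Finset (Finset (Fin h))).filter (fun A => 1 ≤ A.card ∧ A.card ≤ s)).card ≤ (s + 1) * h ^ s := by
  calc _ ≤ ((Finset.range (s + 1)).biUnion (fun i => Finset.powersetCard i (Finset.univ : Finset (Fin h)))).card := by
        refine Finset.card_le_card (fun A hA => ?_)
        rw [Finset.mem_filter] at hA
        rw [Finset.mem_biUnion]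
        exact ⟨A.card, Finset.mem_range.mpr (by omega), Finset.mem_powersetCard.mpr ⟨Finset.subset_univ _, rfl⟩⟩
    _ ≤ ∑ i ∈ Finset.range (s + 1), (Finset.powersetCard i (Finset.univ : Finset (Fin h))).card := Finset.card_biUnion_le
    _ ≤ ∑ _i ∈ Finset.range (s + 1), h ^ s := by
        refine Finset.sum_le_sum (fun i hi => ?_)
        rw [Finset.card_powersetCard, Finset.card_univ, Fintype.card_fin]
        exact (Nat.choose_le_pow h i).trans (Nat.pow_le_pow_right hh (by have := Finset.mem_range.mp hi; omega))
    _ = (s + 1) * h ^ s := by rw [Finset.sum_const, Finset.card_range, smul_eq_mul]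

/-- The anchors are the pairs of small faces. -/
theorem anchors_eq_product (s h : ℕ) :
    anchors s h = ((Finset.univ : Finset (Finset (Fin h))).filter (fun A => 1 ≤ A.card ∧ A.card ≤ s)) ×ˢ
      ((Finset.univ : Finset (Finset (Fin h))).filter (fun A => 1 ≤ A.card ∧ A.card ≤ s)) := by
  ext p
  simp only [anchors, Finset.mem_filter, Finset.mem_univ, true_and, Finset.mem_product]
  tauto

/-- `|anchors s h| ≤ ((s+1) h^s)²`. -/
theorem card_anchors_le (s h : ℕ) (hh : 1 ≤ h) : (anchors s h).card ≤ ((s + 1) * h ^ s) * ((s + 1) * h ^ s) := by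
  rw [anchors_eq_product, Finset.card_product]
  have := card_smallFaces_le s h hh
  exact Nat.mul_le_mul this this

/-! ## Sizes -/

/-- A twist product over a subset of the variables has size `≤ 3h`. -/
theorem complexity_twist_le' (D : Finset (Fin h)) (φ : Fin h → ℂ) (e : Fin h → Fin (h + h)) :
    complexity (∏ b ∈ D, (1 + C (φ b) * X (e b)) : MvPolynomial (Fin (h + h)) ℂ) ≤ 3 * h := by
  have hD : D.card ≤ h := (Finset.card_le_univ D).trans_eq (Fintype.card_fin h)
  calc _ ≤ ∑ b ∈ D, complexity (1 + C (φ b) * X (e b) : MvPolynomial (Fin (h + h)) ℂ) + D.card :=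
        complexity_finset_prod_le _ _
    _ ≤ ∑ _b ∈ D, 2 + D.card := by
        gcongr with b _
        calc _ ≤ complexity (1 : MvPolynomial (Fin (h + h)) ℂ) +
              complexity (C (φ b) * X (e b) : MvPolynomial (Fin (h + h)) ℂ) + 1 := complexity_add_le_holds _ _
          _ ≤ 0 + (complexity (C (φ b) : MvPolynomial (Fin (h + h)) ℂ) +
              complexity (X (e b) : MvPolynomial (Fin (h + h)) ℂ) + 1) + 1 := by
              gcongr
              · rw [← C_1, complexity_C_holds]
              · exact complexity_mul_le_holds _ _
          _ = 2 := by rw [complexity_C_holds, complexity_X_holds]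
    _ ≤ h * 2 + h := by rw [Finset.sum_const, smul_eq_mul]; gcongr
    _ = 3 * h := by ring

/-- One anchor factor has size `≤ 8h + 5`. -/
theorem complexity_anchorFactor_le (α : Finset (Fin h) × Finset (Fin h)) (θ : Finset (Fin h) × Finset (Fin h) → ℂ)
    (φ ψ : Finset (Fin h) × Finset (Fin h) → Fin h → ℂ) :
    complexity ((1 + C (θ α) * (∏ a ∈ α.1, X (Fin.castAdd h a)) * (∏ c ∈ α.2, X (Fin.natAdd h c)) *
      (∏ b ∈ univ \ α.1, (1 + C (φ α b) * X (Fin.castAdd h b))) *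
      (∏ d ∈ univ \ α.2, (1 + C (ψ α d) * X (Fin.natAdd h d)))) : MvPolynomial (Fin (h + h)) ℂ) ≤ 8 * h + 5 := by
  calc _ ≤ complexity (1 : MvPolynomial (Fin (h + h)) ℂ) +
        complexity (C (θ α) * (∏ a ∈ α.1, X (Fin.castAdd h a)) * (∏ c ∈ α.2, X (Fin.natAdd h c)) *
          (∏ b ∈ univ \ α.1, (1 + C (φ α b) * X (Fin.castAdd h b))) *
          (∏ d ∈ univ \ α.2, (1 + C (ψ α d) * X (Fin.natAdd h d))) : MvPolynomial (Fin (h + h)) ℂ) + 1 :=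
        complexity_add_le_holds _ _
    _ ≤ 0 + ((((complexity (C (θ α) : MvPolynomial (Fin (h + h)) ℂ) +
          complexity (∏ a ∈ α.1, X (Fin.castAdd h a) : MvPolynomial (Fin (h + h)) ℂ) + 1) +
          complexity (∏ c ∈ α.2, X (Fin.natAdd h c) : MvPolynomial (Fin (h + h)) ℂ) + 1) +
          complexity (∏ b ∈ univ \ α.1, (1 + C (φ α b) * X (Fin.castAdd h b)) : MvPolynomial (Fin (h + h)) ℂ) + 1) +
          complexity (∏ d ∈ univ \ α.2, (1 + C (ψ α d) * X (Fin.natAdd h d)) : MvPolynomial (Fin (h + h)) ℂ) + 1) + 1 := by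
        gcongr
        · rw [← C_1, complexity_C_holds]
        · refine (complexity_mul_le_holds _ _).trans ?_
          gcongr
          refine (complexity_mul_le_holds _ _).trans ?_
          gcongr
          refine (complexity_mul_le_holds _ _).trans ?_
          gcongr
          exact complexity_mul_le_holds _ _
    _ ≤ 0 + ((((0 + h + 1) + h + 1) + 3 * h + 1) + 3 * h + 1) + 1 := by
        gcongr
        · exact (complexity_C_holds _).le
        · exact ExactCoverDoor.complexity_monomial_le _ _
        · exact ExactCoverDoor.complexity_monomial_le _ _
        · exact complexity_twist_le' _ _ _
        · exact complexity_twist_le' _ _ _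
    _ = 8 * h + 5 := by ring

/-- **Size of 𝔄_s**: `≤ 14 (s+1)² h^{2s+1}` for `h ≥ 1`. -/
theorem complexity_anchoredWitness_le (s h : ℕ) (hh : 1 ≤ h) (θ : Finset (Fin h) × Finset (Fin h) → ℂ)
    (φ ψ : Finset (Fin h) × Finset (Fin h) → Fin h → ℂ) :
    complexity (anchoredWitness s h θ φ ψ) ≤ 14 * (s + 1) ^ 2 * h ^ (2 * s + 1) := by
  rw [anchoredWitness]
  calc _ ≤ ∑ α ∈ anchors s h, complexity ((1 + C (θ α) * (∏ a ∈ α.1, X (Fin.castAdd h a)) *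
          (∏ c ∈ α.2, X (Fin.natAdd h c)) *
          (∏ b ∈ univ \ α.1, (1 + C (φ α b) * X (Fin.castAdd h b))) *
          (∏ d ∈ univ \ α.2, (1 + C (ψ α d) * X (Fin.natAdd h d)))) : MvPolynomial (Fin (h + h)) ℂ) +
        (anchors s h).card := complexity_finset_prod_le _ _
    _ ≤ ∑ _α ∈ anchors s h, (8 * h + 5) + (anchors s h).card := by
        gcongr with α _; exact complexity_anchorFactor_le _ _ _ _
    _ = (anchors s h).card * (8 * h + 6) := by rw [Finset.sum_const, smul_eq_mul]; ring
    _ ≤ (((s + 1) * h ^ s) * ((s + 1) * h ^ s)) * (14 * h) := by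
        gcongr
        · exact card_anchors_le s h hh
        · omega
    _ = 14 * (s + 1) ^ 2 * h ^ (2 * s + 1) := by ring

/-- The size arithmetic: for `h ≥ 9(s+1)²`, `(2h+2)² · 14(s+1)² h^{2s+1} + 2h + 1 ≤ (2h)^{2s+4}`. -/
theorem doorSize_arith (s h : ℕ) (hh : 9 * (s + 1) ^ 2 ≤ h) :
    (h + h + 2) ^ 2 * (14 * (s + 1) ^ 2 * h ^ (2 * s + 1)) + (h + h + 1) ≤ (h + h) ^ (2 * s + 4) := by
  have hs1 : 1 ≤ (s + 1) ^ 2 := Nat.one_le_pow _ _ (by omega)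
  have h9 : 9 ≤ h := le_trans (by nlinarith [hs1]) hh
  have hsq : (h + h + 2) ^ 2 ≤ 9 * h ^ 2 := by nlinarith
  have hpow : 1 ≤ h ^ (2 * s + 1) := Nat.one_le_pow _ _ (by omega)
  have hlin : h ≤ (s + 1) ^ 2 * (h ^ (2 * s + 1) * h ^ 2) := by
    calc h ≤ h ^ 2 := by nlinarith
      _ = 1 * (1 * h ^ 2) := by ring
      _ ≤ (s + 1) ^ 2 * (h ^ (2 * s + 1) * h ^ 2) := by gcongr
  calc (h + h + 2) ^ 2 * (14 * (s + 1) ^ 2 * h ^ (2 * s + 1)) + (h + h + 1)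
      ≤ 9 * h ^ 2 * (14 * (s + 1) ^ 2 * h ^ (2 * s + 1)) + 3 * h := by gcongr; omega
    _ = 126 * ((s + 1) ^ 2 * (h ^ (2 * s + 1) * h ^ 2)) + 3 * h := by ring
    _ ≤ 126 * ((s + 1) ^ 2 * (h ^ (2 * s + 1) * h ^ 2)) + 3 * ((s + 1) ^ 2 * (h ^ (2 * s + 1) * h ^ 2)) := by gcongr
    _ = (129 * (s + 1) ^ 2) * (h ^ (2 * s + 1) * h ^ 2) := by ring
    _ ≤ (16 * h) * (h ^ (2 * s + 1) * h ^ 2) := by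
        gcongr (?_) * _
        calc 129 * (s + 1) ^ 2 ≤ 144 * (s + 1) ^ 2 := by gcongr; norm_num
          _ = 16 * (9 * (s + 1) ^ 2) := by ring
          _ ≤ 16 * h := by gcongr
    _ = 16 * h ^ (2 * s + 4) := by ring
    _ ≤ 2 ^ (2 * s + 4) * h ^ (2 * s + 4) := by
        gcongr
        calc 16 = 2 ^ 4 := by norm_num
          _ ≤ 2 ^ (2 * s + 4) := Nat.pow_le_pow_right (by norm_num) (by omega)
    _ = (h + h) ^ (2 * s + 4) := by rw [← two_mul, mul_pow]

/-- **THE DOOR SIZE (registered link hypothesis `Stmt.anchoredDoor`, discharged):** for every profile bound `s`, a hit by some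
member of 𝔄_s is a hit inside `SmallCircuits ℂ (h+h) (2s+4)` once `h ≥ 9(s+1)²`. -/
theorem anchoredDoor_holds : Stmt.anchoredDoor := by
  intro s
  refine ⟨2 * s + 4, 9 * (s + 1) ^ 2, fun h hh r u w hhit => ?_⟩
  obtain ⟨θ, φ, ψ, hdet⟩ := hhit
  have h1 : 1 ≤ h := le_trans (Nat.one_le_iff_ne_zero.mpr (by positivity)) hh
  obtain ⟨hdeg, hcoeff, hsize⟩ := truncation_spec (anchoredWitness s h θ φ ψ) (h + h)
  refine ⟨∑ e ∈ Finset.range (h + h + 1), homogeneousComponent e (anchoredWitness s h θ φ ψ), ⟨hdeg, ?_⟩, ?_⟩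
  · calc _ ≤ (h + h + 2) ^ 2 * complexity (anchoredWitness s h θ φ ψ) + (h + h + 1) := hsize
      _ ≤ (h + h + 2) ^ 2 * (14 * (s + 1) ^ 2 * h ^ (2 * s + 1)) + (h + h + 1) := by
          gcongr; exact complexity_anchoredWitness_le s h h1 θ φ ψ
      _ ≤ (h + h) ^ (2 * s + 4) := doorSize_arith s h hh
  · have hmat : (Matrix.of fun i j : Fin r => MvPolynomial.coeff
        (∑ a ∈ u i, Finsupp.single (Fin.castAdd h a) 1 +
          ∑ c ∈ w j, Finsupp.single (Fin.natAdd h c) 1)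
        (∑ e ∈ Finset.range (h + h + 1), homogeneousComponent e (anchoredWitness s h θ φ ψ))) =
        Matrix.of fun i j : Fin r => MvPolynomial.coeff
          (∑ a ∈ u i, Finsupp.single (Fin.castAdd h a) 1 +
            ∑ c ∈ w j, Finsupp.single (Fin.natAdd h c) 1) (anchoredWitness s h θ φ ψ) := by
      ext i j
      rw [Matrix.of_apply, Matrix.of_apply, hcoeff _ (degree_partitionExpo_le _ _)]
    rw [hmat]
    exact hdet

/-- **The line's link to item 19717, now unconditional in its door hypothesis:** `AnchoredDoorHitsLowerPairs → PartitionMinorsHitByVP`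
(restated with the Theorems-side copies; same proof as the skeleton's `PartitionMinorsHitByVP_of_anchored` with
`anchoredDoor_holds` plugged in). -/
theorem partitionMinorsHitByVP_of_anchoredDoorHitsLowerPairs
    (hI : ∃ s h₀ : ℕ, ∀ h : ℕ, h₀ ≤ h → ∀ (r : ℕ) (u w : Fin r → Finset (Fin h)),
      Function.Injective u → Function.Injective w →
      IsLowerSet (Set.range u) → IsLowerSet (Set.range w) → AnchoredHit s h r u w) :
    Summit.ValiantsHypothesis.ValiantsHypothesis.Theses.BarrierLever.PartitionMinorsHitByVP := by
  obtain ⟨s, h₀, H⟩ := hI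
  obtain ⟨b, h₁, D⟩ := anchoredDoor_holds s
  refine DownCompression.partitionMinorsHitByVP_of_lowerSets ⟨b, max h₀ h₁, fun h hh r u w hu hw hlu hlw => ?_⟩
  exact D h (le_trans (le_max_right _ _) hh) r u w (H h (le_trans (le_max_left _ _) hh) r u w hu hw hlu hlw)

end

end Summit.ValiantsHypothesis.ValiantsHypothesis.Theorems.BarrierLever.AnchoredPeeling
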